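import Summits.QuantumFields.QCD.Theorems.ExtinctionBuildsQCD.Negative.IndexBudget
import Summits.QuantumFields.QCD.Theorems.SpectralDefectExtinctionTipPricingStubCountMeasurable
import Literature.MathematicalPhysics.QuantumFieldTheory.QCDPhaseQuenched

/-!
# `ExtinctionBuildsQCD` (crux stmt-QuantumFields-8968) — negative-side support, cycle 3 (2/4):
# measurability and integrability of the EXTINCT / TIGHT integrands

Extract of §6c of the standing disprover's work file (cdisprove cycle 3, 2026-08-16). All spectral counts the
route integrates against the Wilson measure — sign defects `#{real roots of charpoly D_W(U,0,1) below t}`,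
coercivity defects `#{|λ(Γ₅D_W(U,μ,1))| < η}`, closed windows `|λ| ≤ η`, shells `w ≤ |λ| ≤ d`, band counts
`real λ ∈ [t₁,t₂]`, and TIGHT's `n₋` — are Borel measurable in the gauge field (instances of the landed
`countMeas_measurable_countP`: each truth set is an increasing countable union of closed sets), and a bounded
measurable functional times the phase-quenched weight `∏_f |det D_W(U,m_f,1)| = |det D(U)|` is integrable
(`integrable_mul_weight`, `integrable_natCount_mul_weight`, `integrable_extinctIntegrand`). Without this the EXTINCT
clause of `SD` — an upper bound on a Bochner integral — would be junk-true and usable by no one; with it, EXTINCT and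
TIGHT can be compared (`Negative/CoercivityCeiling.lean`, `Negative/TwoSidedPin.lean`). Also the measurability the
support item `PositivityDeficitLeDefects` (stmt-QuantumFields-8970) asks for.
-/

noncomputable section

namespace Summit.QuantumFields.QCD.Theorems.ExtinctionBuildsQCD.Negative

open scoped BigOperators Topology Classical MeasureTheory Matrix ComplexConjugate
open Filter MeasureTheory Matrix
open Literature.MathematicalPhysics.QuantumLattice Literature.MathematicalPhysics.QuantumFieldTheory
  Literature.Probability.LatticeModels
open Summit.QuantumFields.QCD.Theses.SpectralDefectExtinction
open Summit.QuantumFields.QCD.Cruxes.TipPricing.HermitianFlowCoarea (countMeas_measurable_countP)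

/-! ## §6c Measurability and integrability of the EXTINCT integrand -/

section Measurable

variable {L : ℕ} [NeZero L]

/-- `1/(k+1) ≤ 1/(j+1)` for `j ≤ k`. -/
private theorem one_div_succ_anti {j k : ℕ} (h : j ≤ k) : (1 : ℝ) / (k + 1) ≤ 1 / (j + 1) :=
  one_div_le_one_div_of_le (by positivity) (by exact_mod_cast Nat.succ_le_succ h)

/-- **The sign-defect count is measurable in the gauge field**: `U ↦ #{real roots of charpoly D_W(U,0,1)
below t}` (with multiplicity) — the truth set `{im = 0, re < t}` is exhausted by the closed sets
`{im = 0, re ≤ t − 1/(j+1)}` (`countMeas_measurable_countP`). This is the measurability EXTINCT(a) and the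
support item `PositivityDeficitLeDefects` silently need. -/
theorem measurable_signDefectCount (t : ℝ) :
    Measurable fun U : GaugeConfig 4 L SU3 => Multiset.countP (fun z : ℂ => z.im = 0 ∧ z.re < t)
      (wilsonDirac (fundamentalRep (Fin 3)) U 0 1).charpoly.roots := by
  have hA : Continuous fun U : GaugeConfig 4 L SU3 => wilsonDirac (fundamentalRep (Fin 3)) U 0 1 :=
    continuous_wilsonDirac _ (continuous_fundamentalRep (Fin 3)) 0 1
  refine countMeas_measurable_countP hA (fun z : ℂ => z.im = 0 ∧ z.re < t)
    (fun j => {z : ℂ | z.im = 0 ∧ z.re ≤ t - 1 / (j + 1)}) (fun j => ?_) (fun j k hjk => ?_) (fun z => ?_)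
  · exact (isClosed_eq Complex.continuous_im continuous_const).inter
      (isClosed_le Complex.continuous_re continuous_const)
  · rintro z ⟨h0, h1⟩
    have := one_div_succ_anti hjk
    exact ⟨h0, by linarith⟩
  · constructor
    · rintro ⟨h0, h1⟩
      obtain ⟨j, hj⟩ := exists_nat_one_div_lt (sub_pos.mpr h1)
      exact ⟨j, h0, by linarith⟩
    · rintro ⟨j, h0, h1⟩
      have : (0 : ℝ) < 1 / (j + 1) := by positivity
      exact ⟨h0, by linarith⟩

/-- **The coercivity-defect count is measurable in the gauge field**: `U ↦ #{eigenvalues of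
Γ₅D_W(U,μ,1) with |re| < η}`. -/
theorem measurable_coercivityDefectCount (μ η : ℝ) :
    Measurable fun U : GaugeConfig 4 L SU3 => Multiset.countP (fun z : ℂ => |z.re| < η)
      (spinorLift gammaFive * wilsonDirac (fundamentalRep (Fin 3)) U μ 1).charpoly.roots := by
  have hA : Continuous fun U : GaugeConfig 4 L SU3 =>
      spinorLift gammaFive * wilsonDirac (fundamentalRep (Fin 3)) U μ 1 :=
    continuous_const.matrix_mul (continuous_wilsonDirac _ (continuous_fundamentalRep (Fin 3)) μ 1)
  refine countMeas_measurable_countP hA (fun z : ℂ => |z.re| < η)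
    (fun j => {z : ℂ | |z.re| ≤ η - 1 / (j + 1)}) (fun j => ?_) (fun j k hjk => ?_) (fun z => ?_)
  · exact isClosed_le (continuous_abs.comp Complex.continuous_re) continuous_const
  · intro z hz
    simp only [Set.mem_setOf_eq] at hz ⊢
    linarith [one_div_succ_anti hjk]
  · constructor
    · intro h
      obtain ⟨j, hj⟩ := exists_nat_one_div_lt (sub_pos.mpr h)
      exact ⟨j, by simp only [Set.mem_setOf_eq]; linarith⟩
    · rintro ⟨j, hj⟩
      simp only [Set.mem_setOf_eq] at hj
      have : (0 : ℝ) < 1 / (j + 1) := by positivity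
      linarith

/-- **The closed-window count is measurable**: `U ↦ #{eigenvalues of Γ₅D_W(U,μ,1) with |re| ≤ η}`. -/
theorem measurable_windowCount (μ η : ℝ) :
    Measurable fun U : GaugeConfig 4 L SU3 => Multiset.countP (fun z : ℂ => |z.re| ≤ η)
      (spinorLift gammaFive * wilsonDirac (fundamentalRep (Fin 3)) U μ 1).charpoly.roots := by
  have hA : Continuous fun U : GaugeConfig 4 L SU3 =>
      spinorLift gammaFive * wilsonDirac (fundamentalRep (Fin 3)) U μ 1 :=
    continuous_const.matrix_mul (continuous_wilsonDirac _ (continuous_fundamentalRep (Fin 3)) μ 1)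
  exact countMeas_measurable_countP hA (fun z : ℂ => |z.re| ≤ η) (fun _ => {z : ℂ | |z.re| ≤ η})
    (fun _ => isClosed_le (continuous_abs.comp Complex.continuous_re) continuous_const)
    (fun _ _ _ => le_rfl) (fun z => ⟨fun h => ⟨0, h⟩, fun ⟨_, h⟩ => h⟩)

/-- **The shell count is measurable**: `U ↦ #{eigenvalues of Γ₅D_W(U,μ,1) with w ≤ |re| ≤ d}`. -/
theorem measurable_shellCount (μ w d : ℝ) :
    Measurable fun U : GaugeConfig 4 L SU3 => Multiset.countP (fun z : ℂ => w ≤ |z.re| ∧ |z.re| ≤ d)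
      (spinorLift gammaFive * wilsonDirac (fundamentalRep (Fin 3)) U μ 1).charpoly.roots := by
  have hA : Continuous fun U : GaugeConfig 4 L SU3 =>
      spinorLift gammaFive * wilsonDirac (fundamentalRep (Fin 3)) U μ 1 :=
    continuous_const.matrix_mul (continuous_wilsonDirac _ (continuous_fundamentalRep (Fin 3)) μ 1)
  exact countMeas_measurable_countP hA (fun z : ℂ => w ≤ |z.re| ∧ |z.re| ≤ d)
    (fun _ => {z : ℂ | w ≤ |z.re| ∧ |z.re| ≤ d})
    (fun _ => (isClosed_le continuous_const (continuous_abs.comp Complex.continuous_re)).inter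
      (isClosed_le (continuous_abs.comp Complex.continuous_re) continuous_const))
    (fun _ _ _ => le_rfl) (fun z => ⟨fun h => ⟨0, h⟩, fun ⟨_, h⟩ => h⟩)

/-- **The negative-eigenvalue count (TIGHT's `n₋`) is measurable**: `U ↦ #{eigenvalues of Γ₅D_W(U,μ,1)
with re < 0}`. -/
theorem measurable_negCount (μ : ℝ) :
    Measurable fun U : GaugeConfig 4 L SU3 => Multiset.countP (fun z : ℂ => z.re < 0)
      (spinorLift gammaFive * wilsonDirac (fundamentalRep (Fin 3)) U μ 1).charpoly.roots := by
  have hA : Continuous fun U : GaugeConfig 4 L SU3 =>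
      spinorLift gammaFive * wilsonDirac (fundamentalRep (Fin 3)) U μ 1 :=
    continuous_const.matrix_mul (continuous_wilsonDirac _ (continuous_fundamentalRep (Fin 3)) μ 1)
  refine countMeas_measurable_countP hA (fun z : ℂ => z.re < 0)
    (fun j => {z : ℂ | z.re ≤ -(1 / (j + 1))}) (fun j => ?_) (fun j k hjk => ?_) (fun z => ?_)
  · exact isClosed_le Complex.continuous_re continuous_const
  · intro z hz
    simp only [Set.mem_setOf_eq] at hz ⊢
    linarith [one_div_succ_anti hjk]
  · constructor
    · intro h
      obtain ⟨j, hj⟩ := exists_nat_one_div_lt (neg_pos.mpr h)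
      exact ⟨j, by simp only [Set.mem_setOf_eq]; linarith⟩
    · rintro ⟨j, hj⟩
      simp only [Set.mem_setOf_eq] at hj
      have : (0 : ℝ) < 1 / (j + 1) := by positivity
      linarith

/-- A root count is at most the matrix size. -/
theorem countP_roots_charpoly_le_card {ι : Type*} [Fintype ι] [DecidableEq ι] (A : Matrix ι ι ℂ)
    (p : ℂ → Prop) [DecidablePred p] : Multiset.countP p A.charpoly.roots ≤ Fintype.card ι :=
  ((Multiset.countP_le_card _ _).trans (Polynomial.card_roots' _)).trans
    (le_of_eq (Matrix.charpoly_natDegree_eq_dim A))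

/-- **A bounded measurable functional times the phase-quenched weight is integrable** against the
Wilson measure (the weight `∏_f |det D_W(U, m_f, 1)| = |det D(U)|` is continuous on the compact
configuration space, `integrable_norm_det_diracMatrix`). -/
theorem integrable_mul_weight {Nf : ℕ} (mq : Fin Nf → ℝ) (β : ℝ) {φ : GaugeConfig 4 L SU3 → ℝ}
    (hφ : Measurable φ) {C : ℝ} (hC : ∀ U, |φ U| ≤ C) :
    Integrable (fun U => φ U * ∏ f : Fin Nf, ‖fermionDet (wilsonDirac (fundamentalRep (Fin 3)) U (mq f) 1)‖)
      (wilsonMeasure (d := 4) (L := L) (fundamentalRep (Fin 3)) β) := by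
  obtain ⟨CW, hCW⟩ := exists_norm_det_diracMatrix_le (S := L) mq
  have hW : ∀ U : GaugeConfig 4 L SU3, (∏ f : Fin Nf, ‖fermionDet (wilsonDirac (fundamentalRep (Fin 3)) U (mq f) 1)‖) =
      ‖(diracMatrix U mq).det‖ := fun U => (norm_det_diracMatrix U mq).symm
  simp_rw [hW]
  refine Integrable.of_bound (hφ.aestronglyMeasurable.mul
    (measurable_norm_det_diracMatrix mq).aestronglyMeasurable) (C * CW)
    (Eventually.of_forall fun U => ?_)
  rw [norm_mul, Real.norm_eq_abs, Real.norm_eq_abs, abs_of_nonneg (norm_nonneg _)]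
  have hC0 : 0 ≤ C := (abs_nonneg _).trans (hC U)
  exact mul_le_mul (hC U) (hCW U) (norm_nonneg _) hC0

/-- An `ℕ`-valued measurable spectral count, bounded by `N`, times the phase-quenched weight is integrable. -/
theorem integrable_natCount_mul_weight {Nf : ℕ} (mq : Fin Nf → ℝ) (β : ℝ) {g : GaugeConfig 4 L SU3 → ℕ}
    (hg : Measurable g) {N : ℕ} (hN : ∀ U, g U ≤ N) :
    Integrable (fun U => (g U : ℝ) * ∏ f : Fin Nf, ‖fermionDet (wilsonDirac (fundamentalRep (Fin 3)) U (mq f) 1)‖)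
      (wilsonMeasure (d := 4) (L := L) (fundamentalRep (Fin 3)) β) :=
  integrable_mul_weight mq β (φ := fun U => (g U : ℝ)) (measurable_from_nat.comp hg) (C := (N : ℝ))
    (fun U => by rw [Nat.abs_cast]; exact_mod_cast hN U)

/-- **The EXTINCT integrand is integrable** (witness data `(reg, c)`, step `k`, tuple `m`, any torus and
coupling): finitely many measurable spectral counts, each bounded by `12·L⁴`, times the continuous weight.
Without this the EXTINCT clause of `SD` would be contentless (a bound on a junk-zero Bochner integral). -/
theorem integrable_extinctIntegrand {Nf : ℕ} (reg : QCDRegularisation Nf) (c : ℝ) (k : ℕ)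
    (m : Fin Nf → ℝ) (β : ℝ) :
    Integrable (fun U : GaugeConfig 4 L SU3 => (∑ f : Fin Nf, ((Multiset.countP (fun z : ℂ => z.im = 0 ∧ z.re < -(reg.mcrit k + reg.a k * m f / reg.Zm k)) (wilsonDirac (fundamentalRep (Fin 3)) U 0 1).charpoly.roots : ℝ) + (Multiset.countP (fun z : ℂ => |z.re| < c * (reg.a k * m f / reg.Zm k)) (spinorLift gammaFive * wilsonDirac (fundamentalRep (Fin 3)) U (reg.mcrit k + reg.a k * m f / reg.Zm k) 1).charpoly.roots : ℝ))) * ∏ f : Fin Nf, ‖fermionDet (wilsonDirac (fundamentalRep (Fin 3)) U (reg.mcrit k + reg.a k * m f / reg.Zm k) 1)‖)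
      (wilsonMeasure (d := 4) (L := L) (fundamentalRep (Fin 3)) β) := by
  refine integrable_mul_weight (fun f => reg.mcrit k + reg.a k * m f / reg.Zm k) β
    (Finset.measurable_sum _ fun f _ => ?_) (C := ∑ _f : Fin Nf, ((Fintype.card (QuarkIdx L) : ℝ) +
      Fintype.card (QuarkIdx L))) (fun U => ?_)
  · have hc : ∀ g : GaugeConfig 4 L SU3 → ℕ, Measurable g → Measurable fun U => (g U : ℝ) :=
      fun g hg => measurable_from_nat.comp hg
    exact (hc _ (measurable_signDefectCount (-(reg.mcrit k + reg.a k * m f / reg.Zm k)))).add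
      (hc _ (measurable_coercivityDefectCount (reg.mcrit k + reg.a k * m f / reg.Zm k)
        (c * (reg.a k * m f / reg.Zm k))))
  · rw [abs_of_nonneg (Finset.sum_nonneg fun f _ => by positivity)]
    refine Finset.sum_le_sum fun f _ => add_le_add ?_ ?_
    · exact_mod_cast countP_roots_charpoly_le_card _ _
    · exact_mod_cast countP_roots_charpoly_le_card _ _

/-- **The band count is measurable**: `U ↦ #{real roots of charpoly D_W(U,0,1) in [t₁, t₂]}` (a closed
predicate). -/
theorem measurable_bandCount {L : ℕ} [NeZero L] (t₁ t₂ : ℝ) :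
    Measurable fun U : GaugeConfig 4 L SU3 => Multiset.countP (fun z : ℂ => z.im = 0 ∧ t₁ ≤ z.re ∧ z.re ≤ t₂)
      (wilsonDirac (fundamentalRep (Fin 3)) U 0 1).charpoly.roots := by
  have hA : Continuous fun U : GaugeConfig 4 L SU3 => wilsonDirac (fundamentalRep (Fin 3)) U 0 1 :=
    continuous_wilsonDirac _ (continuous_fundamentalRep (Fin 3)) 0 1
  exact countMeas_measurable_countP hA (fun z : ℂ => z.im = 0 ∧ t₁ ≤ z.re ∧ z.re ≤ t₂)
    (fun _ => {z : ℂ | z.im = 0 ∧ t₁ ≤ z.re ∧ z.re ≤ t₂})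
    (fun _ => (isClosed_eq Complex.continuous_im continuous_const).inter
      ((isClosed_le continuous_const Complex.continuous_re).inter
        (isClosed_le Complex.continuous_re continuous_const)))
    (fun _ _ _ => le_rfl) (fun z => ⟨fun h => ⟨0, h⟩, fun ⟨_, h⟩ => h⟩)

end Measurable


end Summit.QuantumFields.QCD.Theorems.ExtinctionBuildsQCD.Negative

end
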